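import Literature.IUT.HodgeTheaters.PiAvatarPlaceData
import Literature.IUT.HodgeTheaters.PiAvatarLocalArrowLawL1OfTorsionMonodromy
import HarnessLib

/-!
# The [IUTchI] §6 cone rows at the genuine kit `InitialThetaData.baseKit`: Prop 6.6 (ii)(iii), Prop 6.8 (i), Ex 6.3 (ii) equivariance
# BY NAME, and the good-place local arrow law packaged from abc-iut-L5-d5's (L1)-theorem + the (L2) sign binder (proof-only —
# FLIP TRIGGER (b)(c) of abc-iut-L5-lead RULINGS #62 (2))

S. Mochizuki, *Inter-universal Teichmüller theory I*, kurims manuscript (May 2020), Prop 6.6 (ii)(iii) p. 165, Prop 6.8 (i) p. 167, Ex 6.3 (ii) p. 161,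
Def 6.1 (iii) p. 157 ([IUTchI] Prop 6.6 (ii) p.165) [claim: Mochizuki2012, status: disputed] (D-0012 claim key, series status DISPUTED — kernel theorems
about abc-iut-L5-t4's CONSTRUCTION `InitialThetaData.baseKit` (p445979) over abc-iut-L5-t2's REAL `InitialThetaData`; binders BY NAME:
`CG`, `hS`, `[Normal]`/`hsurj` (t8 `TorsionMonodromy`), `hA` (t1), the bad-pair family `B`, the local-arrow-law family `Λ` (G-L5t4g4-1); nothing
of the series is asserted, no side is taken on [IUTchIII] Cor. 3.12).

## What is proved
* **`localArrowLaw_good_of_torsionMonodromy`** — at a good place the binder `LocalArrowLaw (Π_{X̲→_K} ∩ augGF⁻¹ G_v̲)` REDUCES to its (L2) `sign`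
  field: `le_PiXund` is a containment and (L1) is abc-iut-L5-d5's theorem `TorsionMonodromy.localArrowLaw_L1_local` (p445209, from
  `M : TorsionMonodromy`, `hA`, and the (rel)-type law `hI` «cusp inertia dies in `E[l]`»). So the good-place law family is
  `fun v => localArrowLaw_good_of_torsionMonodromy M hA hI (G_v̲) (hsign v)`.
* Cone rows AT THE GENUINE KIT (consumers of (β) `negCompatModel_baseKit`, p445979, via abc-iut-L5-t13/w4-d073's conditional theorems of
  `PMBaseNegCompatSub`): **`isoTorsor_thetaEllBridge_baseKit`** (Prop 6.6 (ii)), **`isoTorsor_thetaPMEllHT_baseKit`** (Prop 6.6 (iii)),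
  **`ellBridgeSymmetry_baseKit`** (Prop 6.8 (i)), **`equivariant_baseKit`** (Ex 6.3 (ii), every negative `γ ∈ 𝔽_l^{⋊±}`).
Proof-only: no defs, no instance, no notation; typed ≠ inhabited ≠ proved; binders ≠ facts.
-/

noncomputable section

namespace Literature.IUT.HodgeTheaters

open CategoryTheory

universe u v w

section BaseKitConsumers

variable {F : Type u} {K : Type v} {Fbar : Type w} [Field F] [NumberField F] [Field K] [NumberField K]
  [Algebra F K] [Field Fbar] [Algebra F Fbar] [Algebra K Fbar]
  {E : WeierstrassCurve F} [E.IsElliptic] {l : ℕ} {Pb : BadPlacePredicates K}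
  (D : InitialThetaData F K Fbar E l Pb) (CG : D.geom.pe.CuspGalois) (hS : D.CuspClassesNormaliserStable) [Fact l.Prime]

namespace InitialThetaData

/-! ### The good-place local arrow law from `TorsionMonodromy` + the sign binder -/

/-- **At a good place the local arrow law reduces to its sign field**: (L1) is abc-iut-L5-d5's `TorsionMonodromy.localArrowLaw_L1_local`
(Borel stabiliser argument from the torsion-monodromy datum `M`, t1's §1 claims `hA`, and the (rel)-type law `hI`), so only (L2) — Def 6.1 (iii)
«`Aut(†𝒟_v) ↠ {±1}`» read in the chart at `ε⁰` — remains a hypothesis. ([IUTchI] Def 6.1 (iii) p.157) [claim: Mochizuki2012, status: disputed] -/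
theorem localArrowLaw_good_of_torsionMonodromy (M : D.TorsionMonodromy) (hA : D.geom.pe.ArrowCoveringClaims)
    (hI : ∀ k ∈ D.geom.pe.inertia D.geom.pe.ε1, M.tau (D.geom.embK k) = 0) (Gv : Subgroup (Fbar ≃ₐ[F] Fbar))
    (hsign : ∀ n : D.PiC, n ∈ Subgroup.normalizer ((D.PiXarrow ⊓ Gv.comap D.augGF : Subgroup D.PiC) : Set D.PiC) →
      ∀ hn : n ∈ Subgroup.normalizer ((D.PiXund : Subgroup D.PiC) : Set D.PiC),
        ∃ ε : ℤˣ, ∀ x, D.gChart₀Model CG (D.actF CG hS ⟨n, hn⟩ x) = ε • D.gChart₀Model CG x) :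
    D.LocalArrowLaw CG hS (D.PiXarrow ⊓ Gv.comap D.augGF) where
  le_PiXund := inf_le_left.trans D.PiXarrow_le_PiXund
  mem_normalizer_of_conj_le := M.localArrowLaw_L1_local hA hI Gv
  sign := hsign

/-! ### The cone rows at `baseKit` -/

variable [(D.PiXund.subgroupOf D.PiXK).Normal] (hsurj : Function.Surjective D.toFlStarGlobal)
  (hA : D.geom.pe.ArrowCoveringClaims) {B : ∀ v, v ∈ D.indexCopyBad → D.BadPairAt v}
  (Λ : ∀ v, D.LocalArrowLaw CG hS (D.localGroupAt B v))

open Classical in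
/-- **[IUTchI] Prop 6.6 (ii) at the genuine kit**: the isomorphisms between two `𝒟-Θ^{ell}`-bridges of the base kit of the initial Θ-data form a
`{±1}`-torsor (abc-iut-L5-t13 `DThetaEllBridge.isoTorsor_of_negCompatModel` at (β) `negCompatModel_baseKit`).
([IUTchI] Prop 6.6 (ii) p.165) [claim: Mochizuki2012, status: disputed] -/
theorem isoTorsor_thetaEllBridge_baseKit (B₁ B₂ : (D.baseKit B CG hS hsurj hA Λ).DThetaEllBridge) :
    PMBaseKit.DThetaEllBridge.IsoTorsor B₁ B₂ :=
  PMBaseKit.DThetaEllBridge.isoTorsor_of_negCompatModel (D.negCompatModel_baseKit B CG hS hsurj hA Λ) B₁ B₂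

open Classical in
/-- **[IUTchI] Prop 6.6 (iii) at the genuine kit**: the isomorphisms between two `𝒟-Θ^{±ell}`-Hodge theaters of the base kit of the initial
Θ-data form a `{±1}`-torsor. ([IUTchI] Prop 6.6 (iii) p.165) [claim: Mochizuki2012, status: disputed] -/
theorem isoTorsor_thetaPMEllHT_baseKit (H₁ H₂ : (D.baseKit B CG hS hsurj hA Λ).DThetaPMEllHT) :
    PMBaseKit.DThetaPMEllHT.IsoTorsor H₁ H₂ :=
  PMBaseKit.DThetaPMEllHT.isoTorsor_of_negCompatModel (D.negCompatModel_baseKit B CG hS hsurj hA Λ) H₁ H₂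

open Classical in
/-- **[IUTchI] Prop 6.8 (i) at the genuine kit**: the `𝔽_l^{⋊±}`-symmetry of the `𝒟-Θ^{ell}`-bridge of every `𝒟-Θ^{±ell}`-Hodge theater of the
base kit of the initial Θ-data. ([IUTchI] Prop 6.8 (i) p.167) [claim: Mochizuki2012, status: disputed] -/
theorem ellBridgeSymmetry_baseKit (H : (D.baseKit B CG hS hsurj hA Λ).DThetaPMEllHT) :
    PMBaseKit.DThetaPMEllHT.EllBridgeSymmetry H :=
  PMBaseKit.DThetaPMEllHT.ellBridgeSymmetry_of_negCompatModel (D.negCompatModel_baseKit B CG hS hsurj hA Λ) H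

open Classical in
/-- **[IUTchI] Ex 6.3 (ii) at the genuine kit**: `φ^{Θell}_±` is equivariant for every NEGATIVE `γ ∈ 𝔽_l^{⋊±}` (the positive ones are unconditional,
abc-iut-L5-t13 `equivariant_of_isPositive`). ([IUTchI] Ex 6.3 (ii) p.161) [claim: Mochizuki2012, status: disputed] -/
theorem equivariant_baseKit {γ : FlPM l} (hγ : γ.IsNegative) :
    PMBaseKit.Ex63.Equivariant (D.baseKit B CG hS hsurj hA Λ) γ :=
  (D.negCompatModel_baseKit B CG hS hsurj hA Λ).equivariant hγ

end InitialThetaData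

end BaseKitConsumers

end Literature.IUT.HodgeTheaters
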